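import Mathlib
import HarnessLib

/-!
# Graded antipodal Harris for uniform matroids — the first rigorous instance of the LEVEL PRINCIPLE

Helper file for crux `stmt-CriticalPhenomena-4575` (`NoHeavyLowerTail`, route `PercNearOneGluingNoHeavy`),
new-inequality factory seat `prim-ineq-gen-1` (gen 11).  Memo:
`run/shared/lean/prim/prim-ineq-gen-1/FINDING-17-level-principle.md` §5.2 and §9.

**Background.**  For a matroid `M` on `E` and a bipartition `(Y, E ∖ Y)` write `λ(Y) = r(Y) + r(E ∖ Y) − r(E)`
(the connectivity function) and, for an element `p`, the *side spin* `s_p(Y) = [p ∈ cl Y] − [p ∈ cl (E ∖ Y)]`.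
The (conjectural, census-grade) *graded matroid Harris inequality* says `∑_{λ(Y) = ℓ} s_p(Y) s_{p'}(Y) ≥ 0` for every
level `ℓ`; summed over all levels it is the antipodal Harris inequality, and for graphic matroids its two-sided
analogues refine the fibrewise SPLIT / T2-one conjectures of this lane level by level.  This file proves the statement
for the **uniform matroids** `U_{k,n}` (closure of `Y` is `Y` if `|Y| < k` and everything otherwise; the level is
`min(|Y|,k) + min(|Yᶜ|,k)`), by an explicit level-preserving injection of the negative configurations into the
positive ones (`Y ↦ Y ∪ {p'}` resp. `Y ↦ Y ∖ {p'}`).  (This work, 2026-08-20.)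
-/

namespace Summit.CriticalPhenomena.PercolationContinuityZ3.Theorems

namespace GradedHarrisUniform

open Finset

variable {n : ℕ}

/-- Closure operator of the uniform matroid `U_{k,n}` on `Fin n`: a set with fewer than `k` points is closed,
a set with at least `k` points spans everything. [this work] -/
def clU (k : ℕ) (Y : Finset (Fin n)) : Finset (Fin n) := if Y.card < k then Y else univ

/-- Membership in the uniform closure. [this work] -/
theorem mem_clU_iff (k : ℕ) (Y : Finset (Fin n)) (p : Fin n) : p ∈ clU k Y ↔ p ∈ Y ∨ k ≤ Y.card := by
  unfold clU
  split_ifs with h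
  · constructor
    · intro hp; exact Or.inl hp
    · rintro (hp | hk)
      · exact hp
      · exact absurd h (not_lt.mpr hk)
  · constructor
    · intro _; exact Or.inr (not_lt.mp h)
    · intro _; exact mem_univ _

/-- The antipodal *side spin* of the point `p` with respect to the bipartition `(Y, Yᶜ)` of `U_{k,n}`:
`+1` if `p` is spanned by `Y` only, `−1` if by `Yᶜ` only, `0` otherwise. [this work] -/
def spin (k : ℕ) (p : Fin n) (Y : Finset (Fin n)) : ℤ :=
  (if p ∈ clU k Y then 1 else 0) - (if p ∈ clU k Yᶜ then 1 else 0)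

/-- The level `r(Y) + r(Yᶜ)` of the bipartition `(Y, Yᶜ)` in `U_{k,n}`. [this work] -/
def level (k : ℕ) (Y : Finset (Fin n)) : ℕ := min Y.card k + min Yᶜ.card k

/-- A side spin takes only the values `−1, 0, 1`. [this work] -/
theorem spin_cases (k : ℕ) (p : Fin n) (Y : Finset (Fin n)) :
    spin k p Y = -1 ∨ spin k p Y = 0 ∨ spin k p Y = 1 := by
  unfold spin
  split_ifs <;> simp

/-- `s_p(Y) = 1` iff `p` is spanned by `Y` and not by `Yᶜ`. [this work] -/
theorem spin_eq_one_iff (k : ℕ) (p : Fin n) (Y : Finset (Fin n)) :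
    spin k p Y = 1 ↔ p ∈ clU k Y ∧ p ∉ clU k Yᶜ := by
  unfold spin
  split_ifs <;> simp_all

/-- `s_p(Y) = −1` iff `p` is spanned by `Yᶜ` and not by `Y`. [this work] -/
theorem spin_eq_neg_one_iff (k : ℕ) (p : Fin n) (Y : Finset (Fin n)) :
    spin k p Y = -1 ↔ p ∉ clU k Y ∧ p ∈ clU k Yᶜ := by
  unfold spin
  split_ifs <;> simp_all

/-- The product of two side spins lies in `{−1, 0, 1}`. [this work] -/
theorem spin_mul_spin_cases (k : ℕ) (p q : Fin n) (Y : Finset (Fin n)) :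
    spin k p Y * spin k q Y = -1 ∨ spin k p Y * spin k q Y = 0 ∨ spin k p Y * spin k q Y = 1 := by
  rcases spin_cases k p Y with h | h | h <;> rcases spin_cases k q Y with h' | h' | h' <;>
    rw [h, h'] <;> norm_num

/-- A negative configuration has both sides of size `< k` and separates `p` from `q`. [this work] -/
theorem neg_config (k : ℕ) (p q : Fin n) (Y : Finset (Fin n)) (h : spin k p Y * spin k q Y = -1) :
    Y.card < k ∧ Yᶜ.card < k ∧ ((p ∈ Y ∧ q ∉ Y) ∨ (p ∉ Y ∧ q ∈ Y)) := by
  have hp := mem_clU_iff k Y p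
  have hpc := mem_clU_iff k Yᶜ p
  have hq := mem_clU_iff k Y q
  have hqc := mem_clU_iff k Yᶜ q
  have hpY : p ∈ Yᶜ ↔ p ∉ Y := mem_compl
  have hqY : q ∈ Yᶜ ↔ q ∉ Y := mem_compl
  -- the product is `−1` iff the two spins are `1` and `−1` in some order
  have hcase : (spin k p Y = 1 ∧ spin k q Y = -1) ∨ (spin k p Y = -1 ∧ spin k q Y = 1) := by
    rcases spin_cases k p Y with h1 | h1 | h1 <;> rcases spin_cases k q Y with h2 | h2 | h2 <;>
      rw [h1, h2] at h <;> norm_num at h <;> simp [h1, h2]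
  rcases hcase with ⟨h1, h2⟩ | ⟨h1, h2⟩
  · rw [spin_eq_one_iff] at h1
    rw [spin_eq_neg_one_iff] at h2
    obtain ⟨h1a, h1b⟩ := h1
    obtain ⟨h2a, h2b⟩ := h2
    rw [hpc, not_or, not_le, hpY, not_not] at h1b
    rw [hq, not_or, not_le] at h2a
    exact ⟨h2a.2, h1b.2, Or.inl ⟨h1b.1, h2a.1⟩⟩
  · rw [spin_eq_neg_one_iff] at h1
    rw [spin_eq_one_iff] at h2
    obtain ⟨h1a, h1b⟩ := h1
    obtain ⟨h2a, h2b⟩ := h2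
    rw [hp, not_or, not_le] at h1a
    rw [hqc, not_or, not_le, hqY, not_not] at h2b
    exact ⟨h1a.2, h2b.2, Or.inr ⟨h1a.1, h2b.1⟩⟩

/-- The injection: add `q` to the side of `p`, i.e. `Y ↦ Y ∪ {q}` if `p ∈ Y` and `Y ↦ Y ∖ {q}` otherwise. [this work] -/
def phi (p q : Fin n) (Y : Finset (Fin n)) : Finset (Fin n) := if p ∈ Y then insert q Y else Y.erase q

/-- `phi` preserves the level on negative configurations. [this work] -/
theorem level_phi (k : ℕ) (p q : Fin n) (Y : Finset (Fin n)) (h : spin k p Y * spin k q Y = -1) :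
    level k (phi p q Y) = level k Y := by
  obtain ⟨hY, hYc, hsep⟩ := neg_config k p q Y h
  have hcc : Yᶜ.card = n - Y.card := by rw [card_compl, Fintype.card_fin]
  unfold level phi
  rcases hsep with ⟨hp, hq⟩ | ⟨hp, hq⟩
  · rw [if_pos hp]
    have h1 : (insert q Y).card = Y.card + 1 := card_insert_of_notMem hq
    have h2 : (insert q Y)ᶜ.card = n - (Y.card + 1) := by rw [card_compl, Fintype.card_fin, h1]
    have h3 : q ∈ Yᶜ := mem_compl.mpr hq
    have h4 : 1 ≤ Yᶜ.card := card_pos.mpr ⟨q, h3⟩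
    rw [h1, h2, hcc]
    rw [hcc] at hYc h4
    omega
  · rw [if_neg hp]
    have h1 : (Y.erase q).card = Y.card - 1 := card_erase_of_mem hq
    have h2 : (Y.erase q)ᶜ.card = n - (Y.card - 1) := by rw [card_compl, Fintype.card_fin, h1]
    have h4 : 1 ≤ Y.card := card_pos.mpr ⟨q, hq⟩
    have h5 : Y.card ≤ n := by simpa using card_le_univ Y
    rw [h1, h2, hcc]
    rw [hcc] at hYc
    omega

/-- `phi` maps negative configurations to positive ones. [this work] -/
theorem spin_phi (k : ℕ) (p q : Fin n) (Y : Finset (Fin n))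
    (h : spin k p Y * spin k q Y = -1) : spin k p (phi p q Y) * spin k q (phi p q Y) = 1 := by
  obtain ⟨hY, hYc, hsep⟩ := neg_config k p q Y h
  have hcc : Yᶜ.card = n - Y.card := by rw [card_compl, Fintype.card_fin]
  unfold phi
  rcases hsep with ⟨hp, hq⟩ | ⟨hp, hq⟩
  · rw [if_pos hp]
    have h1 : (insert q Y).card = Y.card + 1 := card_insert_of_notMem hq
    have hc : (insert q Y)ᶜ = Yᶜ.erase q := compl_insert
    have h2 : (Yᶜ.erase q).card = Yᶜ.card - 1 := card_erase_of_mem (mem_compl.mpr hq)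
    have hsp : spin k p (insert q Y) = 1 := by
      unfold spin
      rw [hc]
      have e1 : p ∈ clU k (insert q Y) := (mem_clU_iff _ _ _).mpr (Or.inl (mem_insert_of_mem hp))
      have e2 : p ∉ clU k (Yᶜ.erase q) := by
        rw [mem_clU_iff]
        rintro (hm | hk)
        · exact (mem_compl.mp (mem_of_mem_erase hm)) hp
        · omega
      rw [if_pos e1, if_neg e2]; norm_num
    have hsq : spin k q (insert q Y) = 1 := by
      unfold spin
      rw [hc]
      have e1 : q ∈ clU k (insert q Y) := (mem_clU_iff _ _ _).mpr (Or.inl (mem_insert_self q Y))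
      have e2 : q ∉ clU k (Yᶜ.erase q) := by
        rw [mem_clU_iff]
        rintro (hm | hk)
        · exact notMem_erase q Yᶜ hm
        · omega
      rw [if_pos e1, if_neg e2]; norm_num
    rw [hsp, hsq]; norm_num
  · rw [if_neg hp]
    have h1 : (Y.erase q).card = Y.card - 1 := card_erase_of_mem hq
    have hc : (Y.erase q)ᶜ = insert q Yᶜ := compl_erase
    have hqc : q ∉ Yᶜ := fun hm => (mem_compl.mp hm) hq
    have h2 : (insert q Yᶜ).card = Yᶜ.card + 1 := card_insert_of_notMem hqc
    have hpc : p ∈ Yᶜ := mem_compl.mpr hp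
    have hsp : spin k p (Y.erase q) = -1 := by
      unfold spin
      rw [hc]
      have e1 : p ∉ clU k (Y.erase q) := by
        rw [mem_clU_iff]
        rintro (hm | hk)
        · exact hp (mem_of_mem_erase hm)
        · omega
      have e2 : p ∈ clU k (insert q Yᶜ) := (mem_clU_iff _ _ _).mpr (Or.inl (mem_insert_of_mem hpc))
      rw [if_neg e1, if_pos e2]; norm_num
    have hsq : spin k q (Y.erase q) = -1 := by
      unfold spin
      rw [hc]
      have e1 : q ∉ clU k (Y.erase q) := by
        rw [mem_clU_iff]
        rintro (hm | hk)
        · exact notMem_erase q Y hm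
        · omega
      have e2 : q ∈ clU k (insert q Yᶜ) := (mem_clU_iff _ _ _).mpr (Or.inl (mem_insert_self q Yᶜ))
      rw [if_neg e1, if_pos e2]; norm_num
    rw [hsp, hsq]; norm_num

/-- `phi` is injective on negative configurations. [this work] -/
theorem phi_injOn (k : ℕ) (p q : Fin n) :
    Set.InjOn (phi p q) {Y : Finset (Fin n) | spin k p Y * spin k q Y = -1} := by
  intro Y₁ h₁ Y₂ h₂ heq
  obtain ⟨-, -, hs₁⟩ := neg_config k p q Y₁ h₁
  obtain ⟨-, -, hs₂⟩ := neg_config k p q Y₂ h₂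
  have key : ∀ Y : Finset (Fin n), ((p ∈ Y ∧ q ∉ Y) ∨ (p ∉ Y ∧ q ∈ Y)) →
      (p ∈ phi p q Y ↔ p ∈ Y) ∧ (p ∈ Y → Y = (phi p q Y).erase q) ∧ (p ∉ Y → Y = insert q (phi p q Y)) := by
    intro Y hs
    unfold phi
    rcases hs with ⟨hp, hq⟩ | ⟨hp, hq⟩
    · rw [if_pos hp]
      refine ⟨⟨fun _ => hp, fun _ => mem_insert_of_mem hp⟩, fun _ => ?_, fun h => absurd hp h⟩
      rw [erase_insert hq]
    · rw [if_neg hp]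
      refine ⟨⟨fun hm => absurd (mem_of_mem_erase hm) hp, fun h => absurd h hp⟩, fun h => absurd h hp, fun _ => ?_⟩
      rw [insert_erase hq]
  obtain ⟨k₁, e₁, f₁⟩ := key Y₁ hs₁
  obtain ⟨k₂, e₂, f₂⟩ := key Y₂ hs₂
  by_cases hp : p ∈ Y₁
  · have hp₂ : p ∈ Y₂ := k₂.mp (heq ▸ k₁.mpr hp)
    rw [e₁ hp, e₂ hp₂, heq]
  · have hp₂ : p ∉ Y₂ := fun h => hp (k₁.mp (heq ▸ k₂.mpr h))
    rw [f₁ hp, f₂ hp₂, heq]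

/-- **Graded antipodal Harris for the uniform matroid `U_{k,n}`**: on every level `L = r(Y) + r(Yᶜ)` the side spins of
two points are nonnegatively correlated, `∑_{level(Y) = L} s_p(Y)·s_q(Y) ≥ 0`. [this work] -/
theorem sum_spin_mul_spin_nonneg (k L : ℕ) (p q : Fin n) :
    0 ≤ ∑ Y ∈ (univ : Finset (Finset (Fin n))).filter (fun Y => level k Y = L), spin k p Y * spin k q Y := by
  set S := (univ : Finset (Finset (Fin n))).filter (fun Y => level k Y = L) with hS
  set neg := S.filter (fun Y => spin k p Y * spin k q Y = -1) with hneg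
  set pos := S.filter (fun Y => spin k p Y * spin k q Y = 1) with hpos
  have hterm : ∀ Y ∈ S, spin k p Y * spin k q Y =
      (if spin k p Y * spin k q Y = 1 then (1 : ℤ) else 0) - (if spin k p Y * spin k q Y = -1 then (1 : ℤ) else 0) := by
    intro Y _
    rcases spin_mul_spin_cases k p q Y with h | h | h <;> rw [h] <;> norm_num
  rw [sum_congr rfl hterm, sum_sub_distrib, sum_boole, sum_boole]
  have hle : neg.card ≤ pos.card := by
    refine card_le_card_of_injOn (phi p q) (fun Y hY => ?_) (fun Y₁ h₁ Y₂ h₂ heq => ?_)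
    · have hY' : Y ∈ neg := mem_coe.mp hY
      rw [hneg, mem_filter] at hY'
      obtain ⟨hYS, hYn⟩ := hY'
      rw [hS, mem_filter] at hYS
      apply mem_coe.mpr
      rw [hpos, mem_filter, hS, mem_filter]
      exact ⟨⟨mem_univ _, by rw [level_phi k p q Y hYn]; exact hYS.2⟩, spin_phi k p q Y hYn⟩
    · have h₁' : spin k p Y₁ * spin k q Y₁ = -1 := by
        have := mem_coe.mp h₁; rw [hneg] at this; exact (mem_filter.mp this).2
      have h₂' : spin k p Y₂ * spin k q Y₂ = -1 := by
        have := mem_coe.mp h₂; rw [hneg] at this; exact (mem_filter.mp this).2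
      exact phi_injOn k p q h₁' h₂' heq
  have : (neg.card : ℤ) ≤ (pos.card : ℤ) := by exact_mod_cast hle
  rw [hneg, hpos] at this
  linarith

end GradedHarrisUniform

end Summit.CriticalPhenomena.PercolationContinuityZ3.Theorems
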